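import Summits.Ventures.HodgeRepro.FaceReduce

/-!
# Faces of a CM type: flips at places and the `SumTwo` property

Blind re-derivation cell `pub-hodge-repro`, seat `typer` (gen 3).  Continues `CMType.lean` /
`FaceReduce.lean`.

A *place* of the Galois CM field is a conjugate pair of embeddings `{p, c p}`; *flipping* a CM type `Φ`
at the place of `p` exchanges which of `p`, `c p` it contains: `Φ^{(p)} = Φ ∆ {p, c p}`.  The sealed
statement (a) (`Statements.lean` §A, `FaceCensusEngine.lean`: `flipAt`; §A.3: `flip p T = T ∆ {p, p+3}`)
forms, from a CM type `Φ` and two distinct places `π ≠ π′`, the four *corners*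
`Φ, (Φ̄)^{(π)}, (Φ̄)^{(π′)}, Φ^{(ππ′)}` and calls this quadruple a (rank-four) *face*.  The census rows
record that every face satisfies `SumTwo` — every embedding lies in exactly two corners
(`FaceReduce.SumTwo`; this is what makes `⊗_i H¹(A_{T_i})_s` a line of Hodge type `(2,2)`, Deligne
LNM 900 §5 (c), Milne 2020 §2.2 as printed in `route/SOURCES.md`).

This file proves that STRUCTURALLY, for every finite group `G` with complex conjugation `c`, every CM
type `Φ` and every two distinct places:

* `place c p = {p, c p}`, `flipAt c p S = S ∆ place c p` (`mem_flipAt`, `flipAt_flipAt`,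
  `flipAt_comm`), `IsCMType.flipAt` (a flip of a CM type is a CM type);
* `disjoint_place`: the places of `p` and of `p' ∉ {p, c p}` are disjoint;
* `faceCorners c Φ p p' : Fin 4 → Finset G` — the four corners;
* `isCMType_faceCorners` — every corner is a CM type;
* **`sumTwo_faceCorners`** — every face satisfies `SumTwo`.

The sealed degree-6 coordinate faces are instances (`SexticFaces.lean`).
-/

open Finset
open scoped Pointwise symmDiff

namespace HodgeRepro

variable {G : Type*} [Group G] [DecidableEq G]

/-! ### Places and flips -/

/-- The *place* of an embedding `p`: the conjugate pair `{p, c p}`. -/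
def place (c p : G) : Finset G := {p, c * p}

/-- Membership in a place. -/
theorem mem_place {c p x : G} : x ∈ place c p ↔ x = p ∨ x = c * p := by
  simp [place]

/-- An embedding lies in its own place. -/
theorem mem_place_self (c p : G) : p ∈ place c p := by
  simp [place]

/-- The conjugate of an embedding lies in its place. -/
theorem conj_mem_place (c p : G) : c * p ∈ place c p := by
  simp [place]

/-- A place is conjugation-stable pointwise: `x ∈ {p, c p} ↔ c x ∈ {p, c p}`. -/
theorem conj_mem_place_iff {c : G} (hc : IsComplexConj c) {p x : G} :
    c * x ∈ place c p ↔ x ∈ place c p := by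
  simp only [mem_place]
  constructor
  · rintro (h | h)
    · right; rw [← h, hc.mul_mul_cancel]
    · left; exact mul_left_cancel h
  · rintro (h | h)
    · right; rw [h]
    · left; rw [h, hc.mul_mul_cancel]

/-- Two places are either equal or disjoint: if `p' ∉ {p, c p}` they are disjoint. -/
theorem disjoint_place {c : G} (hc : IsComplexConj c) {p p' : G} (h : p' ∉ place c p) :
    Disjoint (place c p) (place c p') := by
  rw [Finset.disjoint_left]
  intro x hx hx'
  rw [mem_place] at hx hx'
  apply h
  rw [mem_place]
  rcases hx with rfl | rfl <;> rcases hx' with h' | h'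
  · exact Or.inl h'.symm
  · right; rw [h', hc.mul_mul_cancel]
  · exact Or.inr h'.symm
  · exact Or.inl (mul_left_cancel h').symm

/-- The *flip* of a subset of embeddings at the place of `p`: `S ∆ {p, c p}`. -/
def flipAt (c p : G) (S : Finset G) : Finset G := S ∆ place c p

/-- Membership in a flip: exactly one of `x ∈ S`, `x ∈ {p, c p}`. -/
theorem mem_flipAt {c p x : G} {S : Finset G} :
    x ∈ flipAt c p S ↔ (x ∈ S ∧ x ∉ place c p) ∨ (x ∈ place c p ∧ x ∉ S) :=
  Finset.mem_symmDiff

/-- Flipping twice at the same place gives the subset back. -/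
theorem flipAt_flipAt (c p : G) (S : Finset G) : flipAt c p (flipAt c p S) = S :=
  symmDiff_symmDiff_cancel_right (place c p) S

/-- Flips at two places commute. -/
theorem flipAt_comm (c p p' : G) (S : Finset G) :
    flipAt c p (flipAt c p' S) = flipAt c p' (flipAt c p S) := by
  unfold flipAt
  rw [symmDiff_right_comm]

/-- Flips preserve cardinality parity-wise in the only way needed: a flip of a CM type is a CM type. -/
theorem IsCMType.flipAt {c : G} (hc : IsComplexConj c) {Φ : Finset G} (hΦ : IsCMType c Φ) (p : G) :
    IsCMType c (flipAt c p Φ) := by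
  intro x
  rw [mem_flipAt, mem_flipAt, conj_mem_place_iff hc, hΦ.conj_mem_iff]
  by_cases h1 : x ∈ Φ <;> by_cases h2 : x ∈ place c p <;> simp [h1, h2]

/-! ### Faces -/

/-- The four corners of the face `(Φ; p, p')`: `Φ`, `(Φ̄)^{(p)}`, `(Φ̄)^{(p')}`, `Φ^{(p p')}`. -/
def faceCorners (c : G) (Φ : Finset G) (p p' : G) : Fin 4 → Finset G
  | 0 => Φ
  | 1 => flipAt c p (c • Φ)
  | 2 => flipAt c p' (c • Φ)
  | 3 => flipAt c p' (flipAt c p Φ)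

variable [Fintype G]

/-- Every corner of a face of a CM type is a CM type. -/
theorem isCMType_faceCorners {c : G} (hc : IsComplexConj c) {Φ : Finset G} (hΦ : IsCMType c Φ)
    (p p' : G) (i : Fin 4) : IsCMType c (faceCorners c Φ p p' i) := by
  fin_cases i
  · exact hΦ
  · exact (hΦ.conj hc).flipAt hc p
  · exact (hΦ.conj hc).flipAt hc p'
  · exact (hΦ.flipAt hc p).flipAt hc p'

/-- **Every face satisfies `SumTwo`**: for a CM type `Φ` and two distinct places (`p' ∉ {p, c p}`),
every embedding lies in exactly two of the four corners. -/
theorem sumTwo_faceCorners {c : G} (hc : IsComplexConj c) {Φ : Finset G} (hΦ : IsCMType c Φ)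
    {p p' : G} (h : p' ∉ place c p) : SumTwo (faceCorners c Φ p p') := by
  intro x
  have hx : ¬ (x ∈ place c p ∧ x ∈ place c p') :=
    fun ⟨h1, h2⟩ => Finset.disjoint_left.1 (disjoint_place hc h) h1 h2
  rw [Finset.card_filter, Fin.sum_univ_four]
  simp only [faceCorners, mem_flipAt, hΦ.smul_eq_compl hc, Finset.mem_compl]
  by_cases ha : x ∈ Φ <;> by_cases hu : x ∈ place c p <;> by_cases hv : x ∈ place c p' <;>
    simp [ha, hu, hv] at hx ⊢

end HodgeRepro
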